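import Summits.BirchSwinnertonDyer.BirchSwinnertonDyer.Theorems.ErratumRoadFiveIMCDivMemberCongruenceErratum
import Summits.BirchSwinnertonDyer.BirchSwinnertonDyer.Theorems.ErratumRoadFiveIMCDivRoadFFFittingCutB
import Literature.NumberTheory.EllipticCurves.Skinner2016.SelmerCoefficientBaseChange
import Literature.NumberTheory.EllipticCurves.PadicCoeffIntegersFrobeniusData
import Literature.RingTheory.PowerSeries.FiniteFreeCoefficients
import HarnessLib

/-!
# K2 crux `IMCDivAtErratumDataAllR` (item stmt-BirchSwinnertonDyer-20169; H3♭ re-oriented), ROAD FF v4-B′, stub 2 —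
# the member congruence `e_m` at the erratum data with the CORRECT `Σ`-hypothesis, from the named facts;
# and the receptacle `(R₀ ⊗_{ℤ_p} 𝒪_m)⟦T⟧`

Cell `bsd-stepL` (run/shared/lean/pub/bsd-stepL/), seat `bsd-stepL-imc-p1` (prover g10, 2026-08-27);
`--supports stmt-BirchSwinnertonDyer-20169 --as helper`; Theses-free. Companion (consumer):
`Theorems/ErratumRoadFiveIMCDivRoadFFFittingFrameBOfFacts.lean` (the deciding stub modulo named facts).

## What this file proves

* §0 receptacle bookkeeping for defn-ty1's recipe (STATUS 2026-08-27T06:59:51Z): the coefficient square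
  `Λ → 𝒪_m⟦T⟧ →(map includeRight) (R₀ ⊗_{ℤ_p} 𝒪_m)⟦T⟧ ← R₀⟦T⟧` commutes when `R₀` is a `ℤ_p`-algebra through
  `toUnr` (`map_includeRight_comp_algebraMap`, `algebraMap_comp_toUnr_eq`); `(R₀ ⊗ 𝒪_m)⟦T⟧` is faithfully flat
  over `R₀⟦T⟧` (`faithfullyFlat_receptacle`, from (T4) `Literature.RingTheory.PowerSeries.faithfullyFlat`);
  `((C p)Λ·R₀⟦T⟧·S')^m = (p^m)` (`map_map_span_C_natCast_pow`); (c) in the consumer's spelling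
  (`span_le_sup_of_receptacle`); re-indexing `max m 1 = m` of `I^n • ⊤`-quotients.
* §1 **`RoadFFMember.nonempty_memberCongruence_erratum_tame`** — the binder `e_m` of
  `P2.RoadFF.fittingCongruenceFrameTwoSlotAt_of_members_descent_le[_printed]` at the erratum data with the
  CORRECT `Σ`-hypothesis `hSM : w ∉ Σ → N/p ∉ w` ("`Σ` contains the primes dividing `M = N/p`", erratum p. 4).
  CORRECTION of g9's `nonempty_memberCongruence_erratum` (p508249), whose binders `hSN : w ∉ Σ → N ∉ w`,
  `hpN : p ∣ N` are jointly UNSATISFIABLE with `hSp : ∀ w ∈ Σ, p ∉ w` (take `w ∣ p`): that theorem is vacuous;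
  this one is not (`Σ := W.sigmaPlacesFinset p K` satisfies `hSp`, `hS`, `hSM`, see the companion file). Then
  **`nonempty_memberCongruence_erratum_of_facts`**: the same with (SelBC) the NAMED FACT
  `Skinner2016.selmerBig_extendScalars_equiv_baseChange` (T2) and (Frob), `Module.Free/Finite ℤ_p 𝒪_m` DISCHARGED by
  defn-ty1's (T1) (`HidaCongruentForm.exists_frobeniusData`, `moduleFree_coeffRing`, `moduleFinite_coeffRing`).

HONEST FRAMING: theorems only (no definition, no named fact, no instance, no `sorry`); CONDITIONAL on the displayed
named facts `hSh`, `hSig`, `hSelBC` (published) — nothing is booked; BSD is proved for no pair; no census number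
moves (T7).

References: [Castella2018Erratum] Thm. 1.1, (b), (c), Lemma 2.1, proof of Thm. 1.1 (pp. 1–4); [Skinner2016PacificMC]
§2.3 (p. 179), §2.6 (2-6-1), §3.1 (p. 192); [SkinnerUrban2014] Prop. 3.2.3; [Benhissi2022] Ch. 1 §9 Prop. 9.4 (3);
[SerreLocalFields1979] III §3; HOME/imc-p1/g9/EM-KERNEL-COMPLETE-20169-imc-p1-g9.md.
-/

set_option autoImplicit false

noncomputable section

open scoped TensorProduct Classical

open CategoryTheory PowerSeries NumberField IsDedekindDomain Field WeierstrassCurve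
open Literature.NumberTheory.GaloisRepresentations Literature.NumberTheory.EllipticCurves
  Literature.NumberTheory.EllipticCurves.BigGaloisRep Literature.NumberTheory.EllipticCurves.GreenbergSelmer
  Literature.NumberTheory.EllipticCurves.Skinner2016 Literature.NumberTheory.EllipticCurves.Rank1Residual
  Literature.NumberTheory.EllipticCurves.Rank1Residual.Typed Literature.NumberTheory.EllipticCurves.ModularForms
  Literature.NumberTheory.EllipticCurves.Castella2018
open Summit.BirchSwinnertonDyer.Rank1Residual.X11b.Halves Summit.BirchSwinnertonDyer.Rank1Residual.X11b.AcSelmer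


/-! ### §0 Small algebra: discrete continuity, re-indexing, the receptacle `(R₀ ⊗_{ℤ_p} 𝒪_m)⟦T⟧` -/

namespace Summit.BirchSwinnertonDyer.Rank1Residual.X11b.RoadFFMember

/-- The ideal `((C p)Λ · R₀⟦T⟧ · S')^m = (p^m) ⊆ S'` for any `R₀⟦T⟧`-algebra `S'`. [folklore] -/
theorem map_map_span_C_natCast_pow (p : ℕ) [Fact p.Prime] (S' : Type*) [CommRing S']
    [Algebra (UnrSeries p) S'] (m : ℕ) :
    (((Ideal.span {(C (p : ℤ_[p]) : IwasawaAlgebra p)}).map (PowerSeries.map (toUnr p))).map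
        (algebraMap (UnrSeries p) S')) ^ m = Ideal.span {((p : ℕ) : S') ^ m} := by
  rw [Ideal.map_span, Set.image_singleton, PowerSeries.map_C, map_natCast, Ideal.map_span,
    Set.image_singleton, map_natCast, map_natCast, Ideal.span_singleton_pow]

/-- Quotients modulo `I^n • ⊤` only depend on the exponent up to equality (re-indexing `max m 1 = m`).
[folklore] -/
theorem nonempty_quotPow_congr_of_eq {R : Type*} [CommRing R] {M N : Type*} [AddCommGroup M] [Module R M]
    [AddCommGroup N] [Module R N] (I : Ideal R) {n n' : ℕ} (h : n = n')
    (e : (M ⧸ I ^ n • (⊤ : Submodule R M)) ≃ₗ[R] (N ⧸ I ^ n • (⊤ : Submodule R N))) :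
    Nonempty ((M ⧸ I ^ n' • (⊤ : Submodule R M)) ≃ₗ[R] (N ⧸ I ^ n' • (⊤ : Submodule R N))) := by
  subst h
  exact ⟨e⟩

section Receptacle

variable (p : ℕ) [Fact p.Prime] [Algebra ℤ_[p] (unrIntegers p)]
  (𝒪 : Type) [CommRing 𝒪] [Algebra ℤ_[p] 𝒪]

/-- The coefficient square `Λ → 𝒪⟦T⟧ →(map includeRight) (R₀ ⊗ 𝒪)⟦T⟧ ← R₀⟦T⟧` commutes, when the
`ℤ_p`-algebra structure of `R₀` is the structure map `toUnr`. [folklore] -/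
theorem map_includeRight_comp_algebraMap (hj : algebraMap ℤ_[p] (unrIntegers p) = toUnr p) :
    (PowerSeries.map (Algebra.TensorProduct.includeRight (R := ℤ_[p]) (A := unrIntegers p)
        (B := 𝒪)).toRingHom).comp (algebraMap (IwasawaAlgebra p) (PowerSeries 𝒪)) =
      (algebraMap (UnrSeries p) (PowerSeries (unrIntegers p ⊗[ℤ_[p]] 𝒪))).comp
        (PowerSeries.map (toUnr p)) := by
  rw [RingHom.algebraMap_toAlgebra, RingHom.algebraMap_toAlgebra, ← PowerSeries.map_comp,
    ← PowerSeries.map_comp, ← hj]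
  congr 1
  ext x
  simp only [RingHom.comp_apply, AlgHom.toRingHom_eq_coe, AlgHom.coe_toRingHom, AlgHom.commutes,
    Algebra.TensorProduct.algebraMap_apply]
  rfl

/-- `(algebraMap R₀ (R₀ ⊗ 𝒪)) ∘ toUnr = includeRight ∘ (ℤ_p → 𝒪)` (the compatibility `hab` of the
member fact's receptacle clause). [folklore] -/
theorem algebraMap_comp_toUnr_eq (hj : algebraMap ℤ_[p] (unrIntegers p) = toUnr p) :
    (algebraMap (unrIntegers p) (unrIntegers p ⊗[ℤ_[p]] 𝒪)).comp (toUnr p) =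
      (Algebra.TensorProduct.includeRight (R := ℤ_[p]) (A := unrIntegers p) (B := 𝒪)).toRingHom.comp
        (algebraMap ℤ_[p] 𝒪) := by
  rw [← hj]
  ext x
  simp only [RingHom.comp_apply, AlgHom.toRingHom_eq_coe, AlgHom.coe_toRingHom, AlgHom.commutes,
    Algebra.TensorProduct.algebraMap_apply]
  rfl

/-- **(c) in the consumer's spelling**: from `(L_m) ⊆ (map a (L·P_Σ)) + (p^{max m 1})` (the member fact's
receptacle clause at level `max m 1 = m`) to `(L_m) ⊆ (algebraMap LS) + ((C p)Λ·R₀⟦T⟧·S')^m`. [folklore] -/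
theorem span_le_sup_of_receptacle {m : ℕ} (hm : 1 ≤ m) (LS : UnrSeries p)
    (Lm : PowerSeries (unrIntegers p ⊗[ℤ_[p]] 𝒪))
    (h : Ideal.span {Lm} ≤
      Ideal.span {PowerSeries.map (algebraMap (unrIntegers p) (unrIntegers p ⊗[ℤ_[p]] 𝒪)) LS} ⊔
        Ideal.span {((p : ℕ) : PowerSeries (unrIntegers p ⊗[ℤ_[p]] 𝒪)) ^ (max m 1)}) :
    Ideal.span {Lm} ≤
      Ideal.span {algebraMap (UnrSeries p) (PowerSeries (unrIntegers p ⊗[ℤ_[p]] 𝒪)) LS} ⊔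
        (((Ideal.span {(C (p : ℤ_[p]) : IwasawaAlgebra p)}).map (PowerSeries.map (toUnr p))).map
          (algebraMap (UnrSeries p) (PowerSeries (unrIntegers p ⊗[ℤ_[p]] 𝒪)))) ^ m := by
  rw [map_map_span_C_natCast_pow, PowerSeries.algebraMap_apply'', ← max_eq_left hm]
  exact h

/-- `(R₀ ⊗_{ℤ_p} 𝒪)⟦T⟧` is faithfully flat over `R₀⟦T⟧` for `𝒪` nontrivial and finite free over `ℤ_p`
(defn-ty1's (T4) `Literature.RingTheory.PowerSeries.faithfullyFlat`). [cite: Benhissi2022, Ch. 1 §9 Prop. 9.4 (3)] -/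
theorem faithfullyFlat_receptacle [Nontrivial 𝒪] [Module.Free ℤ_[p] 𝒪] [Module.Finite ℤ_[p] 𝒪] :
    Module.FaithfullyFlat (UnrSeries p) (PowerSeries (unrIntegers p ⊗[ℤ_[p]] 𝒪)) := by
  haveI : Nontrivial (unrIntegers p ⊗[ℤ_[p]] 𝒪) := Module.FaithfullyFlat.rTensor_nontrivial ℤ_[p] 𝒪 _
  exact Literature.RingTheory.PowerSeries.faithfullyFlat (R := unrIntegers p) (A := unrIntegers p ⊗[ℤ_[p]] 𝒪)

end Receptacle

/-! ### §1 The member congruence `e_m` at the erratum data — CORRECTED `Σ`-hypothesis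
(`Σ ∋` every `w ∣ N/p`; g9's `nonempty_memberCongruence_erratum` asked `Σ ∋` every `w ∣ N` together with
`Σ` away from `p` and `p ∣ N`, which is unsatisfiable) -/

section Erratum

variable {W : WeierstrassCurve ℚ} [W.IsElliptic] [W.IsGloballyMinimal] {p : ℕ} [Fact p.Prime] {m : ℕ}
  {K : Type} [Field K] [NumberField K]

/-- **THE MEMBER CONGRUENCE `e_m` AT THE ERRATUM DATA (tame-level form of the `Σ`-hypothesis).** Same
statement and proof as g9's `nonempty_memberCongruence_erratum` (p508249) EXCEPT that the pair of binders
`hSN : w ∉ Σ → N ∉ w`, `hpN : p ∣ N` (jointly unsatisfiable with `hSp : ∀ w ∈ Σ, p ∉ w` — take `w ∣ p`) is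
replaced by the satisfiable `hSM : w ∉ Σ → N/p ∉ w` ("`Σ` contains the primes dividing `M = N/p`", erratum
p. 4), consumed through `hloc_cofreeRepOver` (p506728). For a Hida member `D` of `f_E` at level `m ≥ 1` with
coefficient ring `𝒪_m`:
`((𝒪_m⟦T⟧ ⊗_Λ X^Σ_𝔮(E/K_∞)) ⧸ ((C p)Λ·𝒪_m⟦T⟧)^m) ≃ₗ[𝒪_m⟦T⟧] (XBig κ (A_{g_m}|_{Γ_K}) 𝔮 Σ ⧸ ((C p)Λ·𝒪_m⟦T⟧)^m)`,
`X := AcSelmer.XAc (W.baseChange K) p κ 𝔮 Σ γ`. CONDITIONAL on the displayed (F1) named facts `hSh`,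
`hSig`, on (SelBC) `hSelBC` and on (Frob) `t₀, b, b', hfb, hfb'`. Nothing is booked.
[cite: Castella2018Erratum, Thm. 1.1, (b), Lemma 2.1 and proof of Thm. 1.1 (pp. 1–4)]
[cite: Skinner2016PacificMC, §2.6 (2-6-1), §3.1 (b)(d)] [cite: SkinnerUrban2014, Prop. 3.2.3] -/
theorem nonempty_memberCongruence_erratum_tame (hSh : SkinnerUrban2014.prop323_XAc_equiv_XBigDecomp)
    (hSig : selmerBig_eq_selmerBigDecomp_of_unramifiedOutside)
    (hp : 5 ≤ p) (hirr : Irr W p) (hK : IsImaginaryQuadratic K) (hsplit : SatisfiesHeegnerHypothesis p K)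
    (𝔮 : HeightOneSpectrum (𝓞 K)) (h𝔮 : ((p : ℕ) : 𝓞 K) ∈ 𝔮.asIdeal) (φ : 𝔮.adicCompletion K →+* ℚ_[p])
    (hiv : ∀ Q : (W.baseChange ℚ_[p]).toAffine.Point, p • Q = 0 → Q = 0)
    (S : Set (HeightOneSpectrum (𝓞 K))) (hSfin : S.Finite) (hSp : ∀ w ∈ S, ((p : ℕ) : 𝓞 K) ∉ w.asIdeal)
    (hS : ∀ w : HeightOneSpectrum (𝓞 K), w ∉ S → ((p : ℕ) : 𝓞 K) ∉ w.asIdeal →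
      (W.baseChange K).HasGoodReductionAt w)
    (hSM : ∀ w : HeightOneSpectrum (𝓞 K), w ∉ S → ((W.conductorNorm ℤ / p : ℕ) : 𝓞 K) ∉ w.asIdeal)
    (κ : ZpExtension K p) (hκ : κ.IsAnticyclotomic) (γ : absoluteGaloisGroup K) [Fact (κ.IsTopGenerator γ)]
    (D : HidaCongruentMember W p m) (hm : 1 ≤ m)
    [TopologicalSpace (IwasawaAlgebra p)]
    [ContinuousSMul (IwasawaAlgebra p) (BigRepModule ℤ_[p] p (PrimaryTorsion (geomPoints (W.baseChange K)) p))]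
    [TopologicalSpace (PowerSeries (padicCoeffIntegers D.ι))]
    [ContinuousSMul (PowerSeries (padicCoeffIntegers D.ι)) (BigRepModule (padicCoeffIntegers D.ι) p
      (CoeffExtension ℤ_[p] (padicCoeffIntegers D.ι) (PrimaryTorsion (geomPoints (W.baseChange K)) p)))]
    [ContinuousSMul (PowerSeries (padicCoeffIntegers D.ι)) (BigRepModule (padicCoeffIntegers D.ι) p
      (Cofree D.Δ.ρ (padicCoeffField D.ι)))]
    (hSelBC : Nonempty (selmerBig κ (ContinuousRep.extendScalars (R := ℤ_[p]) (G := absoluteGaloisGroup K)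
        (A := PrimaryTorsion (geomPoints (W.baseChange K)) p) (padicCoeffIntegers D.ι)
        ((W.baseChange K).primaryTorsionGaloisRep p)) 𝔮 S ≃ₗ[PowerSeries (padicCoeffIntegers D.ι)]
      PowerSeries (padicCoeffIntegers D.ι) ⊗[IwasawaAlgebra p]
        selmerBig κ ((W.baseChange K).primaryTorsionGaloisRep p) 𝔮 S))
    {ι' : Type*} [Fintype ι'] (t₀ : padicCoeffIntegers D.ι →ₗ[ℤ_[p]] ℤ_[p]) (b b' : ι' → padicCoeffIntegers D.ι)
    (hfb : ∀ a : padicCoeffIntegers D.ι, a = ∑ i, t₀ (a * b' i) • b i)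
    (hfb' : ∀ a : padicCoeffIntegers D.ι, a = ∑ i, t₀ (a * b i) • b' i) :
    Nonempty ((((PowerSeries (padicCoeffIntegers D.ι)) ⊗[IwasawaAlgebra p]
          AcSelmer.XAc (W.baseChange K) p κ 𝔮 S γ) ⧸
        (((Ideal.span {(C (p : ℤ_[p]) : IwasawaAlgebra p)}).map
            (algebraMap (IwasawaAlgebra p) (PowerSeries (padicCoeffIntegers D.ι)))) ^ m •
          (⊤ : Submodule (PowerSeries (padicCoeffIntegers D.ι))
            ((PowerSeries (padicCoeffIntegers D.ι)) ⊗[IwasawaAlgebra p] AcSelmer.XAc (W.baseChange K) p κ 𝔮 S γ))))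
        ≃ₗ[PowerSeries (padicCoeffIntegers D.ι)]
      (XBig κ (D.Δ.cofreeRepOver K) 𝔮 S ⧸
        (((Ideal.span {(C (p : ℤ_[p]) : IwasawaAlgebra p)}).map
            (algebraMap (IwasawaAlgebra p) (PowerSeries (padicCoeffIntegers D.ι)))) ^ m •
          (⊤ : Submodule (PowerSeries (padicCoeffIntegers D.ι)) (XBig κ (D.Δ.cofreeRepOver K) 𝔮 S))))) := by
  haveI : Module.Free ℤ_[p] (padicCoeffIntegers D.ι) := moduleFree_of_frobData D.ι t₀ b b' hfb
  -- (unr): inertia at every `w ∉ Σ`, `w ∤ p` acts trivially on `E_K[p^∞]` (good reduction there; Néron–Ogg–Shafarevich)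
  have hunr : ∀ w : HeightOneSpectrum (𝓞 K), w ∉ S → ((p : ℕ) : 𝓞 K) ∉ w.asIdeal →
      ∀ σ : absoluteGaloisGroup (w.adicCompletion K), σ ∈ absInertia (w.adicCompletion K) →
        ∀ P : PrimaryTorsion (geomPoints (W.baseChange K)) p,
          absGaloisRestrict K (w.adicCompletion K) σ • P = P :=
    fun w hw hpw σ hσ P =>
      BigRep.smul_primaryTorsion_eq_of_mem_absInertia_of_hasGoodReductionAt (W.baseChange K) p (hS w hw hpw)
        hpw hσ P
  -- (F1)
  have hF1 := nonempty_XAc_equiv_XBig W p K hSh hSig hp hirr hK hsplit 𝔮 h𝔮 S hSfin hSp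
    (fun w hw hpw σ P => by
      obtain ⟨σ, hσ⟩ := σ
      rw [WeierstrassCurve.primaryTorsionGaloisRep_apply]
      exact hunr w hw hpw σ hσ P)
    κ hκ γ
  exact nonempty_memberCongruence κ m ((W.baseChange K).primaryTorsionGaloisRep p)
    (ContinuousRep.extendScalars (R := ℤ_[p]) (G := absoluteGaloisGroup K)
      (A := PrimaryTorsion (geomPoints (W.baseChange K)) p) (padicCoeffIntegers D.ι)
      ((W.baseChange K).primaryTorsionGaloisRep p))
    (D.Δ.cofreeRepOver K) 𝔮 S hF1 hSelBC t₀ b b' hfb hfb' (exists_torsionCongruence_baseChange D K)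
    (hdiv_extendScalars_erratum K (padicCoeffIntegers D.ι) (W := W))
    (hglob_extendScalars_erratum K (padicCoeffIntegers D.ι) κ hK hirr m hm)
    (hloc_extendScalars (padicCoeffIntegers D.ι) (W.baseChange K) κ 𝔮 S (geomPoints_baseChange_divisible K (W := W))
      (BigRep.hdec_geomPoints_of_padicTorsion W p K 𝔮 φ hiv) hunr m hm)
    (hdiv_cofreeRepOver D.Δ)
    (hglob_cofreeRepOver_erratum D K hm κ hK hirr m hm)
    (hloc_cofreeRepOver D K hm κ 𝔮 S (BigRep.hdec_geomPoints_of_padicTorsion W p K 𝔮 φ hiv) hSM m hm)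

/-- **`e_m` at the erratum data from the NAMED FACTS (SelBC) and (F1), with (Frob), `Module.Free/Finite ℤ_p 𝒪_m`
discharged by defn-ty1's (T1)** (`HidaCongruentForm.exists_frobeniusData`, `moduleFree_coeffRing`,
`moduleFinite_coeffRing`; needs `N/p ≠ 0`). Same conclusion as `nonempty_memberCongruence_erratum_tame`.
CONDITIONAL on the three named facts; nothing booked. [cite: Castella2018Erratum, (b), Lemma 2.1 and proof of Thm. 1.1 (p. 4)]
[cite: Skinner2016PacificMC, §2.3 (p. 179), §2.6 (2-6-1)] [cite: SkinnerUrban2014, Prop. 3.2.3] -/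
theorem nonempty_memberCongruence_erratum_of_facts (hSh : SkinnerUrban2014.prop323_XAc_equiv_XBigDecomp)
    (hSig : selmerBig_eq_selmerBigDecomp_of_unramifiedOutside)
    (hSelBC : Skinner2016.selmerBig_extendScalars_equiv_baseChange)
    (hp : 5 ≤ p) (hirr : Irr W p) (hK : IsImaginaryQuadratic K) (hsplit : SatisfiesHeegnerHypothesis p K)
    (𝔮 : HeightOneSpectrum (𝓞 K)) (h𝔮 : ((p : ℕ) : 𝓞 K) ∈ 𝔮.asIdeal) (φ : 𝔮.adicCompletion K →+* ℚ_[p])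
    (hiv : ∀ Q : (W.baseChange ℚ_[p]).toAffine.Point, p • Q = 0 → Q = 0)
    (S : Set (HeightOneSpectrum (𝓞 K))) (hSfin : S.Finite) (hSp : ∀ w ∈ S, ((p : ℕ) : 𝓞 K) ∉ w.asIdeal)
    (hS : ∀ w : HeightOneSpectrum (𝓞 K), w ∉ S → ((p : ℕ) : 𝓞 K) ∉ w.asIdeal →
      (W.baseChange K).HasGoodReductionAt w)
    (hSM : ∀ w : HeightOneSpectrum (𝓞 K), w ∉ S → ((W.conductorNorm ℤ / p : ℕ) : 𝓞 K) ∉ w.asIdeal)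
    (κ : ZpExtension K p) (hκ : κ.IsAnticyclotomic) (γ : absoluteGaloisGroup K) [Fact (κ.IsTopGenerator γ)]
    (D : HidaCongruentMember W p m) (hm : 1 ≤ m) [NeZero (W.conductorNorm ℤ / p)]
    [TopologicalSpace (IwasawaAlgebra p)]
    [ContinuousSMul (IwasawaAlgebra p) (BigRepModule ℤ_[p] p (PrimaryTorsion (geomPoints (W.baseChange K)) p))]
    [TopologicalSpace (PowerSeries (padicCoeffIntegers D.ι))]
    [ContinuousSMul (PowerSeries (padicCoeffIntegers D.ι)) (BigRepModule (padicCoeffIntegers D.ι) p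
      (CoeffExtension ℤ_[p] (padicCoeffIntegers D.ι) (PrimaryTorsion (geomPoints (W.baseChange K)) p)))]
    [ContinuousSMul (PowerSeries (padicCoeffIntegers D.ι)) (BigRepModule (padicCoeffIntegers D.ι) p
      (Cofree D.Δ.ρ (padicCoeffField D.ι)))] :
    Nonempty ((((PowerSeries (padicCoeffIntegers D.ι)) ⊗[IwasawaAlgebra p]
          AcSelmer.XAc (W.baseChange K) p κ 𝔮 S γ) ⧸
        (((Ideal.span {(C (p : ℤ_[p]) : IwasawaAlgebra p)}).map
            (algebraMap (IwasawaAlgebra p) (PowerSeries (padicCoeffIntegers D.ι)))) ^ m •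
          (⊤ : Submodule (PowerSeries (padicCoeffIntegers D.ι))
            ((PowerSeries (padicCoeffIntegers D.ι)) ⊗[IwasawaAlgebra p] AcSelmer.XAc (W.baseChange K) p κ 𝔮 S γ))))
        ≃ₗ[PowerSeries (padicCoeffIntegers D.ι)]
      (XBig κ (D.Δ.cofreeRepOver K) 𝔮 S ⧸
        (((Ideal.span {(C (p : ℤ_[p]) : IwasawaAlgebra p)}).map
            (algebraMap (IwasawaAlgebra p) (PowerSeries (padicCoeffIntegers D.ι)))) ^ m •
          (⊤ : Submodule (PowerSeries (padicCoeffIntegers D.ι)) (XBig κ (D.Δ.cofreeRepOver K) 𝔮 S))))) :=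
  haveI : Module.Free ℤ_[p] (padicCoeffIntegers D.ι) := D.moduleFree_coeffRing
  haveI : Module.Finite ℤ_[p] (padicCoeffIntegers D.ι) := D.moduleFinite_coeffRing
  D.exists_frobeniusData.elim fun _n h => h.elim fun t₀ h => h.elim fun b h => h.elim fun b' h =>
    nonempty_memberCongruence_erratum_tame hSh hSig hp hirr hK hsplit 𝔮 h𝔮 φ hiv S hSfin hSp hS hSM κ hκ γ D hm
      (Skinner2016.nonempty_selmerBig_primaryTorsion_extendScalars_equiv W κ (padicCoeffIntegers D.ι) 𝔮 S hSelBC)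
      t₀ b b' h.1 h.2

end Erratum

end Summit.BirchSwinnertonDyer.Rank1Residual.X11b.RoadFFMember

end
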